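/-
Copyright: cell `pub-balaban-gaps` (G2), seat ne6 (row NE7b), `prover-pub-balaban-gaps-ne6-g20-0`. Project licence.
-/
import Summits.QuantumFields.BalabanUV.T4Continuum.Spine.NE7b.CompactFibreMeanActionSU2SecondOrder
import Summits.QuantumFields.BalabanUV.T4Continuum.Spine.NE7b.CompactFibreActionVarianceSU2
import Summits.QuantumFields.BalabanUV.T4Continuum.Spine.NE7b.CompactFibreMeanActionSUNDeriv

/-!
# JUNCTION J5: THE FREE ENERGY's NEXT TERM `β·(−log Z_{SU(2)}(β) − (3∕2)log β − log(2√π)) → 3∕16`, THE SPECIFIC HEAT AS A DERIVATIVE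
# `β²·d⟨Re tr(1−U)⟩_β∕dβ → −3∕2`, AND `(−log Z_N)″ = −Var_β` FOR EVERY `N` (row NE7b, node U5c; MODEL, [folklore]; junction of gen 20's V54 + V55 + V56 with V50)

Cell `pub-balaban-gaps` (G2 spine census) for the `pub-balaban` T⁴ crux NE7b (`T4WeightBudget.RelWeightBound`; NOT PRINTED, NOT PROVED).  Crux-route work under
`Spine/NE7b/`; imports the landed V54 `CompactFibreMeanActionSU2SecondOrder` (`tendsto_mul_limit_sub_scaled_plaquetteMass_SU2`, `plaquetteMass_SU2_pos`; it re-exports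
V45's `tendsto_scaled_plaquetteMass_SU2`), V55 `CompactFibreActionVarianceSU2` (`tendsto_sq_mul_actionVariance_SU2`) and V56 `CompactFibreMeanActionSUNDeriv`
(`hasDerivAt_meanAction_SUN`, `actionVariance_SUN_nonneg`, `meanAction_SUN_antitone`; it re-exports V50's `hasDerivAt_freeEnergy_SUN`) + Mathlib (`Real.log_le_sub_one_of_pos`,
`Real.one_sub_inv_le_log_of_pos`, `Antitone.concaveOn_univ_of_deriv`); no `def`, zero `sorry`, nothing of Bałaban's asserted.

THE LOCATED QUESTION.  V45 proved `−log Z(β) − (3∕2)log β → log(2√π)`; V54 the mass's next term `β((2√π)⁻¹ − (√β)³Z(β)) → (3∕16)(2√π)⁻¹`; V55 `β²Var_β(s) → 3∕2`; V56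
`⟨s⟩_β′ = −Var_β(s)` for every N.  QUESTION (J5): the same numbers in the FREE ENERGY and in the DERIVATIVE of the mean action.  ANSWER ([folklore], `s = Re tr(1−U)`,
one `SU(2)` plaquette under Haar):
* §1 **`tendsto_mul_freeEnergy_secondOrder_SU2`**: `β·(−log Z(β) − (3∕2)log β − log(2√π)) → 3∕16` — squeeze `1 − f∕K ≤ log(K∕f) ≤ K∕f − 1` (`f = (√β)³Z`, `K = (2√π)⁻¹`)
  against V54's `β(K − f) → 3K∕16` and V45's `f → K`;
* §2 **`tendsto_sq_mul_deriv_meanAction_SU2`**: `β²·(d∕dβ)(∫s·e^{−βs}dHaar ∕ ∫e^{−βs}dHaar) → −3∕2` (V56's derivative `= −Var_β`, V55's limit) — the specific heat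
  `−β²⟨s⟩_β′ → dim SU(2)∕2`.
* §3 (EVERY `N`, EVERY REAL `β`) **`deriv_freeEnergy_SUN_eq`** (`(−log Z_N)′ = ⟨s⟩` as functions, V50), **`hasDerivAt_deriv_freeEnergy_SUN`**: `(−log Z_N)″(β) =
  −(W∕Z − (M∕Z)²) = −Var_β(s)` — THE FREE ENERGY's CURVATURE IS MINUS THE VARIANCE, i.e. `(log Z_N)″ = Var_β` (V55's honest remark (iii) discharged);
  **`deriv_deriv_freeEnergy_SUN_nonpos`**, **`freeEnergy_SUN_concaveOn_univ`** (`−log Z_N` concave on ALL of ℝ; V50 had `[0, ∞)`); and for `N = 2`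
  **`tendsto_sq_mul_deriv_deriv_freeEnergy_SU2`**: `β²·(−log Z)″(β) → −3∕2` — consistent with §1's `3∕(16β)` term only through the NEXT order, which is not claimed.

HONEST REMARKS.  (i) MODEL ∕ [folklore]: Haar calculus of ONE `SU(2)` plaquette variable; nothing of the interacting measure.  (ii) §1, §2 and the last limit of §3 are
N = 2; §3's identities are every N but carry no constants.  (iii) (A3) ∕ (A1c) NOT asserted;
NC-NE7b-α UNRULED.  BY-NAME EFFECT ON THE WALL: NONE.  NE7b NOT PRINTED ∕ NOT PROVED; spine PROVED 0∕9; rung (B)+1 on ONE finite T⁴ — NOT infinite volume, NOT the mass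
gap, NOT Clay.
HONEST DEPENDENCY: continuum YM on T⁴ ⇐ BetaPertH ∧ nine spine estimates (0/9 proved); BetaPertH ⇐ (D1) ∧ (D4) ∧ CAP+tail;
G-an2-4 gates asym, D1 and NE2/3/4.  This file changes none of it.
-/

set_option autoImplicit false

noncomputable section

open Real Set MeasureTheory Filter Topology
open Literature.MathematicalPhysics.QuantumFieldTheory (haarProbability)
open Summit.QuantumFields.BalabanUV.T4Continuum.NE7b.CompactFibrePlaquetteMassSU2Limit (tendsto_scaled_plaquetteMass_SU2)
open Summit.QuantumFields.BalabanUV.T4Continuum.NE7b.CompactFibreMeanActionSU2SecondOrder (tendsto_mul_limit_sub_scaled_plaquetteMass_SU2 plaquetteMass_SU2_pos)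
open Summit.QuantumFields.BalabanUV.T4Continuum.NE7b.CompactFibreActionVarianceSU2 (tendsto_sq_mul_actionVariance_SU2)
open Summit.QuantumFields.BalabanUV.T4Continuum.NE7b.CompactFibreMeanActionSUNMonotone (hasDerivAt_freeEnergy_SUN)
open Summit.QuantumFields.BalabanUV.T4Continuum.NE7b.CompactFibreMeanActionSUNDeriv (hasDerivAt_meanAction_SUN actionVariance_SUN_nonneg meanAction_SUN_antitone)

namespace Summit.QuantumFields.BalabanUV.T4Continuum.NE7b.CompactFibreFreeEnergySU2SecondOrder

/-! ### §1 The free energy's next term -/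

/-- **THE FREE ENERGY's NEXT TERM**: `β·(−log ∫e^{−β Re tr(1−U)}dHaar_{SU(2)} − (3∕2)·log β − log(2√π)) → 3∕16` as `β → ∞`, i.e.
`−log Z(β) = (3∕2)log β + log(2√π) + 3∕(16β) + o(1∕β)` (squeeze of `log(K∕f)` between `1 − f∕K` and `K∕f − 1`). [folklore] -/
theorem tendsto_mul_freeEnergy_secondOrder_SU2 :
    Tendsto (fun β : ℝ => β *
        (-Real.log (∫ U, Real.exp (-(β * (Matrix.trace (1 - (U : Matrix (Fin 2) (Fin 2) ℂ))).re)) ∂(haarProbability (Matrix.specialUnitaryGroup (Fin 2) ℂ)))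
          - 3 / 2 * Real.log β - Real.log (2 * Real.sqrt Real.pi)))
      atTop (𝓝 (3 / 16)) := by
  have hsπ : 0 < Real.sqrt Real.pi := Real.sqrt_pos.2 Real.pi_pos
  have hK : 0 < (2 * Real.sqrt Real.pi)⁻¹ := by positivity
  have hKf := tendsto_mul_limit_sub_scaled_plaquetteMass_SU2
  have hf := tendsto_scaled_plaquetteMass_SU2
  -- the two squeezing sequences: `β(K − f)/f → (3K/16)/K` and `β(K − f)/K → (3K/16)/K`
  have e : 3 / (32 * Real.sqrt Real.pi) / (2 * Real.sqrt Real.pi)⁻¹ = 3 / 16 := by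
    field_simp
    ring
  have hup : Tendsto (fun β : ℝ => β * ((2 * Real.sqrt Real.pi)⁻¹ - Real.sqrt β ^ 3 *
      ∫ U, Real.exp (-(β * (Matrix.trace (1 - (U : Matrix (Fin 2) (Fin 2) ℂ))).re)) ∂(haarProbability (Matrix.specialUnitaryGroup (Fin 2) ℂ)))
      / (Real.sqrt β ^ 3 * ∫ U, Real.exp (-(β * (Matrix.trace (1 - (U : Matrix (Fin 2) (Fin 2) ℂ))).re)) ∂(haarProbability (Matrix.specialUnitaryGroup (Fin 2) ℂ))))
      atTop (𝓝 (3 / 16)) := by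
    rw [← e]; exact hKf.div hf hK.ne'
  have hlow : Tendsto (fun β : ℝ => β * ((2 * Real.sqrt Real.pi)⁻¹ - Real.sqrt β ^ 3 *
      ∫ U, Real.exp (-(β * (Matrix.trace (1 - (U : Matrix (Fin 2) (Fin 2) ℂ))).re)) ∂(haarProbability (Matrix.specialUnitaryGroup (Fin 2) ℂ)))
      / (2 * Real.sqrt Real.pi)⁻¹) atTop (𝓝 (3 / 16)) := by
    rw [← e]; exact hKf.div_const _
  refine tendsto_of_tendsto_of_tendsto_of_le_of_le' hlow hup ?_ ?_
  · filter_upwards [eventually_gt_atTop (0 : ℝ)] with β hβ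
    have hs : 0 < Real.sqrt β := Real.sqrt_pos.2 hβ
    have hZ := plaquetteMass_SU2_pos hβ.le
    have hfpos : 0 < Real.sqrt β ^ 3 *
        ∫ U, Real.exp (-(β * (Matrix.trace (1 - (U : Matrix (Fin 2) (Fin 2) ℂ))).re)) ∂(haarProbability (Matrix.specialUnitaryGroup (Fin 2) ℂ)) := by positivity
    -- `log(K/f) ≥ 1 − f/K`, i.e. `β(K − f)/K ≤ β·log(K/f)`
    have hlog := Real.one_sub_inv_le_log_of_pos (div_pos hK hfpos)
    have hid : -Real.log (∫ U, Real.exp (-(β * (Matrix.trace (1 - (U : Matrix (Fin 2) (Fin 2) ℂ))).re)) ∂(haarProbability (Matrix.specialUnitaryGroup (Fin 2) ℂ)))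
        - 3 / 2 * Real.log β - Real.log (2 * Real.sqrt Real.pi)
        = Real.log ((2 * Real.sqrt Real.pi)⁻¹ / (Real.sqrt β ^ 3 *
            ∫ U, Real.exp (-(β * (Matrix.trace (1 - (U : Matrix (Fin 2) (Fin 2) ℂ))).re)) ∂(haarProbability (Matrix.specialUnitaryGroup (Fin 2) ℂ)))) := by
      rw [Real.log_div hK.ne' hfpos.ne', Real.log_inv, Real.log_mul (pow_pos hs 3).ne' hZ.ne', Real.log_pow, Real.log_sqrt hβ.le]
      push_cast
      ring
    rw [hid]
    have hinv : ((2 * Real.sqrt Real.pi)⁻¹ / (Real.sqrt β ^ 3 *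
        ∫ U, Real.exp (-(β * (Matrix.trace (1 - (U : Matrix (Fin 2) (Fin 2) ℂ))).re)) ∂(haarProbability (Matrix.specialUnitaryGroup (Fin 2) ℂ))))⁻¹
        = (Real.sqrt β ^ 3 * ∫ U, Real.exp (-(β * (Matrix.trace (1 - (U : Matrix (Fin 2) (Fin 2) ℂ))).re)) ∂(haarProbability (Matrix.specialUnitaryGroup (Fin 2) ℂ)))
          / (2 * Real.sqrt Real.pi)⁻¹ := by rw [inv_div]
    rw [hinv] at hlog
    have hrew : β * (((2 * Real.sqrt Real.pi)⁻¹ - Real.sqrt β ^ 3 *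
        ∫ U, Real.exp (-(β * (Matrix.trace (1 - (U : Matrix (Fin 2) (Fin 2) ℂ))).re)) ∂(haarProbability (Matrix.specialUnitaryGroup (Fin 2) ℂ)))
        / (2 * Real.sqrt Real.pi)⁻¹)
        = β * (1 - (Real.sqrt β ^ 3 * ∫ U, Real.exp (-(β * (Matrix.trace (1 - (U : Matrix (Fin 2) (Fin 2) ℂ))).re)) ∂(haarProbability (Matrix.specialUnitaryGroup (Fin 2) ℂ)))
          / (2 * Real.sqrt Real.pi)⁻¹) := by
      field_simp
    rw [mul_div_assoc, hrew]
    exact mul_le_mul_of_nonneg_left hlog hβ.le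
  · filter_upwards [eventually_gt_atTop (0 : ℝ)] with β hβ
    have hs : 0 < Real.sqrt β := Real.sqrt_pos.2 hβ
    have hZ := plaquetteMass_SU2_pos hβ.le
    have hfpos : 0 < Real.sqrt β ^ 3 *
        ∫ U, Real.exp (-(β * (Matrix.trace (1 - (U : Matrix (Fin 2) (Fin 2) ℂ))).re)) ∂(haarProbability (Matrix.specialUnitaryGroup (Fin 2) ℂ)) := by positivity
    -- `log(K/f) ≤ K/f − 1`, i.e. `β·log(K/f) ≤ β(K − f)/f`
    have hlog := Real.log_le_sub_one_of_pos (div_pos hK hfpos)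
    have hid : -Real.log (∫ U, Real.exp (-(β * (Matrix.trace (1 - (U : Matrix (Fin 2) (Fin 2) ℂ))).re)) ∂(haarProbability (Matrix.specialUnitaryGroup (Fin 2) ℂ)))
        - 3 / 2 * Real.log β - Real.log (2 * Real.sqrt Real.pi)
        = Real.log ((2 * Real.sqrt Real.pi)⁻¹ / (Real.sqrt β ^ 3 *
            ∫ U, Real.exp (-(β * (Matrix.trace (1 - (U : Matrix (Fin 2) (Fin 2) ℂ))).re)) ∂(haarProbability (Matrix.specialUnitaryGroup (Fin 2) ℂ)))) := by
      rw [Real.log_div hK.ne' hfpos.ne', Real.log_inv, Real.log_mul (pow_pos hs 3).ne' hZ.ne', Real.log_pow, Real.log_sqrt hβ.le]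
      push_cast
      ring
    rw [hid]
    have hrew : β * (((2 * Real.sqrt Real.pi)⁻¹ - Real.sqrt β ^ 3 *
        ∫ U, Real.exp (-(β * (Matrix.trace (1 - (U : Matrix (Fin 2) (Fin 2) ℂ))).re)) ∂(haarProbability (Matrix.specialUnitaryGroup (Fin 2) ℂ)))
        / (Real.sqrt β ^ 3 * ∫ U, Real.exp (-(β * (Matrix.trace (1 - (U : Matrix (Fin 2) (Fin 2) ℂ))).re)) ∂(haarProbability (Matrix.specialUnitaryGroup (Fin 2) ℂ))))
        = β * ((2 * Real.sqrt Real.pi)⁻¹ / (Real.sqrt β ^ 3 *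
            ∫ U, Real.exp (-(β * (Matrix.trace (1 - (U : Matrix (Fin 2) (Fin 2) ℂ))).re)) ∂(haarProbability (Matrix.specialUnitaryGroup (Fin 2) ℂ))) - 1) := by
      field_simp
    rw [mul_div_assoc, hrew]
    exact mul_le_mul_of_nonneg_left hlog hβ.le

/-! ### §2 The specific heat as a derivative -/

/-- **THE SPECIFIC HEAT AS A DERIVATIVE**: `β²·(d∕dβ)(∫Re tr(1−U)·e^{−β Re tr(1−U)}dHaar ∕ ∫e^{−β Re tr(1−U)}dHaar) → −3∕2` as `β → ∞` — the tilted mean action of one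
`SU(2)` plaquette DECREASES at the Gaussian rate `3∕(2β²)` (V56: the derivative is `−Var_β`; V55: `β²Var_β → 3∕2`). [folklore] -/
theorem tendsto_sq_mul_deriv_meanAction_SU2 :
    Tendsto (fun β : ℝ => β ^ 2 * deriv (fun b : ℝ =>
        (∫ U, (Matrix.trace (1 - (U : Matrix (Fin 2) (Fin 2) ℂ))).re * Real.exp (-(b * (Matrix.trace (1 - (U : Matrix (Fin 2) (Fin 2) ℂ))).re))
            ∂(haarProbability (Matrix.specialUnitaryGroup (Fin 2) ℂ)))
          / ∫ U, Real.exp (-(b * (Matrix.trace (1 - (U : Matrix (Fin 2) (Fin 2) ℂ))).re)) ∂(haarProbability (Matrix.specialUnitaryGroup (Fin 2) ℂ))) β)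
      atTop (𝓝 (-(3 / 2))) := by
  have h := tendsto_sq_mul_actionVariance_SU2.neg
  refine h.congr fun β => ?_
  rw [(hasDerivAt_meanAction_SUN (N := 2) β).deriv]
  ring

/-! ### §3 The free energy's second derivative is minus the variance — every `N`, every real `β` -/

section everyN

variable {N : ℕ}

/-- **`(−log Z_N)′ = ⟨s⟩` AS FUNCTIONS ON ℝ** (every `N`; V50's `hasDerivAt_freeEnergy_SUN` under `funext`). [folklore] -/
theorem deriv_freeEnergy_SUN_eq :
    deriv (fun b : ℝ => -Real.log (∫ V, Real.exp (-(b * (Matrix.trace (1 - (V : Matrix (Fin N) (Fin N) ℂ))).re)) ∂(haarProbability (Matrix.specialUnitaryGroup (Fin N) ℂ))))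
      = fun b : ℝ =>
        (∫ V, (Matrix.trace (1 - (V : Matrix (Fin N) (Fin N) ℂ))).re * Real.exp (-(b * (Matrix.trace (1 - (V : Matrix (Fin N) (Fin N) ℂ))).re))
            ∂(haarProbability (Matrix.specialUnitaryGroup (Fin N) ℂ)))
          / ∫ V, Real.exp (-(b * (Matrix.trace (1 - (V : Matrix (Fin N) (Fin N) ℂ))).re)) ∂(haarProbability (Matrix.specialUnitaryGroup (Fin N) ℂ)) := by
  funext b
  exact (hasDerivAt_freeEnergy_SUN (N := N) b).deriv

/-- **THE FREE ENERGY's SECOND DERIVATIVE IS MINUS THE VARIANCE, EVERY `N`, EVERY REAL `β`**: `(−log Z_N)″(β) = −(W∕Z − (M∕Z)²) = −Var_β(Re tr(1−V))`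
(`Z, M, W` the tilted zeroth ∕ first ∕ second moments of `Re tr(1−V)` under Haar) — V50's first derivative composed with V56's `hasDerivAt_meanAction_SUN`;
equivalently `(log Z_N)″ = Var_β`, the identity V55 left unproved. [folklore] -/
theorem hasDerivAt_deriv_freeEnergy_SUN (β : ℝ) :
    HasDerivAt (deriv (fun b : ℝ => -Real.log (∫ V, Real.exp (-(b * (Matrix.trace (1 - (V : Matrix (Fin N) (Fin N) ℂ))).re)) ∂(haarProbability (Matrix.specialUnitaryGroup (Fin N) ℂ)))))
      (-((∫ V, (Matrix.trace (1 - (V : Matrix (Fin N) (Fin N) ℂ))).re ^ 2 * Real.exp (-(β * (Matrix.trace (1 - (V : Matrix (Fin N) (Fin N) ℂ))).re))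
            ∂(haarProbability (Matrix.specialUnitaryGroup (Fin N) ℂ)))
          / (∫ V, Real.exp (-(β * (Matrix.trace (1 - (V : Matrix (Fin N) (Fin N) ℂ))).re)) ∂(haarProbability (Matrix.specialUnitaryGroup (Fin N) ℂ)))
        - ((∫ V, (Matrix.trace (1 - (V : Matrix (Fin N) (Fin N) ℂ))).re * Real.exp (-(β * (Matrix.trace (1 - (V : Matrix (Fin N) (Fin N) ℂ))).re))
              ∂(haarProbability (Matrix.specialUnitaryGroup (Fin N) ℂ)))
            / ∫ V, Real.exp (-(β * (Matrix.trace (1 - (V : Matrix (Fin N) (Fin N) ℂ))).re)) ∂(haarProbability (Matrix.specialUnitaryGroup (Fin N) ℂ))) ^ 2)) β := by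
  rw [deriv_freeEnergy_SUN_eq]
  exact hasDerivAt_meanAction_SUN (N := N) β

/-- **`(−log Z_N)″ ≤ 0` AT EVERY REAL `β`, EVERY `N`** (the variance is nonnegative: V56's `actionVariance_SUN_nonneg`). [folklore] -/
theorem deriv_deriv_freeEnergy_SUN_nonpos (β : ℝ) :
    deriv (deriv (fun b : ℝ =>
      -Real.log (∫ V, Real.exp (-(b * (Matrix.trace (1 - (V : Matrix (Fin N) (Fin N) ℂ))).re)) ∂(haarProbability (Matrix.specialUnitaryGroup (Fin N) ℂ))))) β ≤ 0 := by
  rw [(hasDerivAt_deriv_freeEnergy_SUN (N := N) β).deriv]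
  have h := actionVariance_SUN_nonneg (N := N) β
  linarith

/-- **THE FREE ENERGY `−log Z_N` IS CONCAVE ON ALL OF ℝ, EVERY `N`** (V50's `freeEnergy_SUN_concaveOn` had `[0, ∞)` from a correlation inequality; here from
`(−log Z_N)′ = ⟨s⟩` antitone on ℝ, V56's `meanAction_SUN_antitone`). [folklore] -/
theorem freeEnergy_SUN_concaveOn_univ :
    ConcaveOn ℝ Set.univ (fun b : ℝ =>
      -Real.log (∫ V, Real.exp (-(b * (Matrix.trace (1 - (V : Matrix (Fin N) (Fin N) ℂ))).re)) ∂(haarProbability (Matrix.specialUnitaryGroup (Fin N) ℂ)))) := by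
  refine Antitone.concaveOn_univ_of_deriv (fun b => (hasDerivAt_freeEnergy_SUN (N := N) b).differentiableAt) ?_
  rw [deriv_freeEnergy_SUN_eq]
  exact meanAction_SUN_antitone (N := N)

end everyN

/-- **`β²·(−log Z)″(β) → −3∕2` FOR ONE `SU(2)` PLAQUETTE**: the free energy's curvature is asymptotically `−3∕(2β²)` (§3 at `N = 2` with V55's `β²Var_β → 3∕2`) —
consistent with §1's expansion `−log Z(β) = (3∕2)log β + log(2√π) + 3∕(16β) + o(1∕β)`, whose formal second derivative is `−3∕(2β²) + O(β⁻³)`. [folklore] -/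
theorem tendsto_sq_mul_deriv_deriv_freeEnergy_SU2 :
    Tendsto (fun β : ℝ => β ^ 2 * deriv (deriv (fun b : ℝ =>
        -Real.log (∫ U, Real.exp (-(b * (Matrix.trace (1 - (U : Matrix (Fin 2) (Fin 2) ℂ))).re)) ∂(haarProbability (Matrix.specialUnitaryGroup (Fin 2) ℂ))))) β)
      atTop (𝓝 (-(3 / 2))) := by
  have h := tendsto_sq_mul_actionVariance_SU2.neg
  refine h.congr fun β => ?_
  rw [(hasDerivAt_deriv_freeEnergy_SUN (N := 2) β).deriv]
  ring

end Summit.QuantumFields.BalabanUV.T4Continuum.NE7b.CompactFibreFreeEnergySU2SecondOrder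

end
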